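import Summits.QuantumFields.YangMills.Theorems.BalabanLadderIROddTorusWeightedRP
import Literature.Probability.LatticeModels.ChessboardEstimateOddTorus
import HarnessLib

/-!
# Rows of one plaquette orientation on the odd torus: the site ↔ plaquette dictionary of the odd-torus chessboard

Support file (seat ym-infvol-p3, fleet R136 (i); bears on crux `IR` = stmt-QuantumFields-19354, registered line
«af-pincer-T» clause (iii_T) of `TypShellCond` / line «hamming» clause (ii); count-neutral helper).

The abstract chessboard estimate on block tori of odd side
(`Literature.Probability.LatticeModels.chessboard_le_rpow_odd`) is stated for set functions on the block indices
`BlockIdx d L = Fin d → ZMod L` with the reflections `cᵢ ↦ 1 - cᵢ` of every axis.  For the plaquettes of ONE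
orientation `o = (i < j)` of the Wilson theory on `(ℤ/L)^d`, `L = 2S+1`, the Osterwalder–Seiler reflection
`θ t = 1 - t` acts on the base point by `t ↦ 1 - t` when the direction is TRANSVERSE to `o` but by `t ↦ -t` when it is
IN-PLANE (the temporal plaquette `t → t+1` goes to `-t → 1-t`).  The dictionary `toPlaq o c = (c - (S+1)·𝟙_o, o)`
(shift the in-plane coordinates by `S+1`) makes the action uniform: `toPlaq o (cellReflect 0 1 c) = ϑ (toPlaq o c)`
(`toPlaq_cellReflect_zero`), translations act by translations, and the axis exchange `0 ↔ k` acts by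
`plaqSwap 0 k ∘ toPlaq o = toPlaq (oSwap k o) ∘ (· ∘ swap 0 k)`.  Under this dictionary the CLOSED positive
half-line `{1,…,S+1}` of axis `0` consists of positive plaquettes plus the SHARED row (transverse case) or of negative
plaquettes plus the CUT row (in-plane case) — `rows_transverse`, `rows_inplane`.

Also: the chessboard functional `psi ρ β c o A = ⟨exp(c ∑_{x ∈ A} φ_{toPlaq o x})⟩_{Λ,β}` and its elementary
properties (`psi_nonneg`, `psi_empty`, `one_le_psi`, `psi_translate`, `psi_swap`).

HONEST FRAMING: finite-torus bookkeeping; no claim about the mass gap.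
-/

noncomputable section

open MeasureTheory Finset
open Literature.MathematicalPhysics.QuantumFieldTheory
open Literature.MathematicalPhysics.QuantumFieldTheory.WilsonRP
open Literature.MathematicalPhysics.QuantumFieldTheory.WilsonOddRP
open Literature.Barriers.CriticalPhenomena.NonGibbs
open Literature.Probability.LatticeModels
open Summit.QuantumFields.YangMills.Theorems.SoloBlind

namespace Summit.QuantumFields.YangMills.Theorems.OddTorusChessboard

variable {d L N : ℕ} [NeZero d] [NeZero L] {G : Type*} [Group G] [TopologicalSpace G]
  [IsTopologicalGroup G] [CompactSpace G] [MeasurableSpace G] [BorelSpace G]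
  (ρ : G →* Matrix (Fin N) (Fin N) ℂ)

/-! ### §1. Orientations and the dictionary `toPlaq` -/

variable (d) in
/-- Plaquette orientations `(i, j)`, `i < j`. -/
abbrev Orient : Type := {p : Fin d × Fin d // p.1 < p.2}

/-- Whether the axis `k` lies IN the plane of the orientation `o` (reducible, hence decidable). -/
abbrev InPlane (o : Orient d) (k : Fin d) : Prop := o.1.1 = k ∨ o.1.2 = k

variable (L) in
/-- The row shift: `S + 1 = L/2 + 1` on the in-plane axes of `o`, `0` on the transverse ones. -/
def rowShift (o : Orient d) (k : Fin d) : ZMod L := if InPlane o k then ((L / 2 + 1 : ℕ) : ZMod L) else 0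

/-- **The dictionary**: the block index `c` labels the plaquette of orientation `o` based at `c - (S+1)·𝟙_o`. -/
def toPlaq (o : Orient d) (c : BlockIdx d L) : Plaquette d L := (fun k => c k - rowShift L o k, o)

omit [NeZero d] [NeZero L] in
/-- Base point of `toPlaq`. -/
@[simp] theorem toPlaq_fst (o : Orient d) (c : BlockIdx d L) (k : Fin d) : (toPlaq o c).1 k = c k - rowShift L o k := rfl

omit [NeZero d] [NeZero L] in
/-- Orientation of `toPlaq`. -/
@[simp] theorem toPlaq_snd (o : Orient d) (c : BlockIdx d L) : (toPlaq o c).2 = o := rfl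

omit [NeZero d] [NeZero L] in
/-- `toPlaq o` is injective. -/
theorem toPlaq_injective (o : Orient d) : Function.Injective (toPlaq (L := L) o) := by
  intro c c' h
  funext k
  have := congrArg (fun p : Plaquette d L => p.1 k) h
  simpa using this

omit [NeZero d] [NeZero L] in
/-- Every plaquette of orientation `o` is in the image of `toPlaq o`. -/
theorem toPlaq_surj (o : Orient d) {q : Plaquette d L} (hq : q.2 = o) :
    toPlaq o (fun k => q.1 k + rowShift L o k) = q := by
  refine Prod.ext (funext fun k => ?_) (by rw [toPlaq_snd, hq])
  simp

/-! ### §2. Translations -/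

omit [NeZero d] [NeZero L] in
/-- The dictionary intertwines the block translations with the torus translations. -/
theorem image_toPlaq_image_cellTranslate (o : Orient d) (k : Fin d) (a : ZMod L) (A : Finset (BlockIdx d L)) :
    (A.image (cellTranslate k a)).image (toPlaq o) = plaqTranslate (Pi.single k a) (A.image (toPlaq o)) := by
  rw [plaqTranslate, Finset.image_image, Finset.image_image]
  refine Finset.image_congr fun c _ => ?_
  refine Prod.ext (funext fun m => ?_) rfl
  simp only [Function.comp_apply, toPlaq_fst, cellTranslate_apply, toPlaq_snd, Pi.add_apply]
  by_cases h : m = k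
  · subst h; simp; ring
  · simp [h]

/-! ### §3. The reflection of axis `0` -/

omit [NeZero L] in
/-- On the odd torus `L = 2S+1`: `(S+1) + (S+1) = 1` in `ZMod L`. -/
theorem rowShift_two_mul (hL : Odd L) : (((L / 2 + 1 : ℕ) : ZMod L)) + ((L / 2 + 1 : ℕ) : ZMod L) = 1 := by
  obtain ⟨S, rfl⟩ := hL
  have h : (2 * S + 1) / 2 = S := by omega
  rw [h, ← Nat.cast_add, show S + 1 + (S + 1) = (2 * S + 1) + 1 by ring, Nat.cast_add, ZMod.natCast_self,
    zero_add, Nat.cast_one]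

omit [NeZero L] in
/-- **The dictionary intertwines `cellReflect 0 1` (`c₀ ↦ 1 - c₀`) with the plaquette reflection `ϑ`** — for
transverse orientations because `ϑ` acts on the base time by `t ↦ 1 - t`, for in-plane (temporal) ones because it acts
by `t ↦ -t` and the rows are shifted by `S + 1` with `2(S+1) ≡ 1`. -/
theorem toPlaq_cellReflect_zero (hL : Odd L) (o : Orient d) (c : BlockIdx d L) :
    toPlaq o (cellReflect 0 1 c) = plaqReflect (toPlaq o c) := by
  refine Prod.ext (funext fun m => ?_) rfl
  simp only [toPlaq_fst, cellReflect_apply, plaqReflect, toPlaq_snd]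
  by_cases hm : m = 0
  · subst hm
    simp only [Function.update_self]
    by_cases ho : o.1.1 = 0
    · rw [if_pos ho, timeReflect_apply_zero, shift_apply_self, toPlaq_fst]
      have hin : InPlane o 0 := Or.inl ho
      simp only [rowShift, if_pos hin]
      have h2 := rowShift_two_mul hL
      linear_combination -h2
    · rw [if_neg ho, timeReflect_apply_zero, toPlaq_fst]
      have hnot : ¬ InPlane o 0 := by
        rintro (h | h)
        · exact ho h
        · exact absurd (h ▸ o.2) (by simp)
      simp only [rowShift, if_neg hnot]
      ring
  · simp only [Function.update_of_ne hm]
    by_cases ho : o.1.1 = 0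
    · rw [if_pos ho, timeReflect_apply_of_ne _ hm, shift_apply_of_ne _ hm, toPlaq_fst]
    · rw [if_neg ho, timeReflect_apply_of_ne _ hm, toPlaq_fst]

omit [NeZero L] in
/-- The image of a reflected pattern is the reflected image. -/
theorem image_toPlaq_image_cellReflect_zero (hL : Odd L) (o : Orient d) (A : Finset (BlockIdx d L)) :
    (A.image (cellReflect 0 1)).image (toPlaq o) = (A.image (toPlaq o)).image plaqReflect := by
  rw [Finset.image_image, Finset.image_image]
  exact Finset.image_congr fun c _ => toPlaq_cellReflect_zero hL o c

/-! ### §4. Rows: which plaquettes are positive, cut, shared -/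

omit [NeZero L] in
/-- The value of `t - (S+1)` on the odd torus. -/
theorem val_sub_rowShift (hL : Odd L) (t : ZMod L) :
    (t - ((L / 2 + 1 : ℕ) : ZMod L)).val = if L / 2 + 1 ≤ t.val then t.val - (L / 2 + 1) else t.val + L - (L / 2 + 1) := by
  obtain ⟨S, rfl⟩ := hL
  haveI : NeZero (2 * S + 1) := ⟨by omega⟩
  have hS : (2 * S + 1) / 2 = S := by omega
  rw [hS]
  have ht := ZMod.val_lt t
  conv_lhs => rw [← ZMod.natCast_zmod_val t]
  split_ifs with h
  · rw [← Nat.cast_sub h, ZMod.val_cast_of_lt (by omega)]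
  · have : ((t.val : ℕ) : ZMod (2 * S + 1)) - ((S + 1 : ℕ) : ZMod (2 * S + 1)) =
        ((t.val + (2 * S + 1) - (S + 1) : ℕ) : ZMod (2 * S + 1)) := by
      rw [sub_eq_iff_eq_add, ← Nat.cast_add, Nat.sub_add_cancel (by omega), Nat.cast_add, ZMod.natCast_self,
        add_zero]
    rw [this, ZMod.val_cast_of_lt (by omega)]

omit [NeZero L] in
/-- **Transverse orientation** (`0 ∉ o`): rows `1 ≤ c₀ ≤ S` are positive plaquettes, the row `c₀ = S+1` is SHARED. -/
theorem rows_transverse {o : Orient d} (ho : o.1.1 ≠ 0) (c : BlockIdx d L) :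
    ((c 0).val ≠ 0 ∧ (c 0).val ≤ L / 2 → IsOPosPlaq (toPlaq o c)) ∧
      ((c 0).val = L / 2 + 1 → IsOSharedPlaq (toPlaq o c)) := by
  have hnot : ¬ InPlane o 0 := by
    rintro (h | h)
    · exact ho h
    · exact absurd (h ▸ o.2) (by simp)
  have h0 : (toPlaq o c).1 0 = c 0 := by simp [rowShift, hnot]
  refine ⟨fun h => ?_, fun h => ?_⟩
  · refine ⟨?_, ?_⟩ <;> rw [h0] <;> omega
  · exact ⟨ho, by rw [h0]; exact h⟩

/-- **In-plane orientation** (`0 ∈ o`, i.e. `o = (0, j)`): rows `c₀ = 0` and `S+2 ≤ c₀` are positive plaquettes, the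
row `c₀ = S+1` is CUT. -/
theorem rows_inplane (hL : Odd L) (hL3 : 3 ≤ L) {o : Orient d} (ho : o.1.1 = 0) (c : BlockIdx d L) :
    (((c 0).val = 0 ∨ L / 2 + 2 ≤ (c 0).val) → IsOPosPlaq (toPlaq o c)) ∧
      ((c 0).val = L / 2 + 1 → IsOCrossPlaq (toPlaq o c)) := by
  have hin : InPlane o 0 := Or.inl ho
  have h0 : (toPlaq o c).1 0 = c 0 - ((L / 2 + 1 : ℕ) : ZMod L) := by simp [rowShift, hin]
  have hv := val_sub_rowShift hL (c 0)
  have hlt := ZMod.val_lt (c 0)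
  obtain ⟨S, hS⟩ := hL
  have hS2 : L / 2 = S := by omega
  refine ⟨fun h => ?_, fun h => ?_⟩
  · refine ⟨?_, ?_⟩ <;> rw [h0, hv] <;> split_ifs with h1 <;> omega
  · exact ⟨ho, by rw [h0, hv, if_pos (by omega)]; omega⟩

/-! ### §5. Axis exchange -/

/-- The orientation part of `plaqSwap 0 k` (independent of the base point). -/
def oSwap (k : Fin d) (o : Orient d) : Orient d := (plaqSwap (L := L) 0 k ((fun _ => 0), o)).2

omit [NeZero L] in
/-- The exchange of the coordinates `0 ↔ k` on block indices. -/
def swapIdx (k : Fin d) : BlockIdx d L ≃ BlockIdx d L where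
  toFun c := fun m => c (Equiv.swap 0 k m)
  invFun c := fun m => c (Equiv.swap 0 k m)
  left_inv c := by funext m; simp [Equiv.swap_apply_self]
  right_inv c := by funext m; simp [Equiv.swap_apply_self]

omit [NeZero L] in
/-- Pointwise formula for `swapIdx`. -/
@[simp] theorem swapIdx_apply (k : Fin d) (c : BlockIdx d L) (m : Fin d) : swapIdx k c m = c (Equiv.swap 0 k m) := rfl

omit [NeZero L] in
/-- The orientation part of `plaqSwap 0 k` does not depend on the base point. -/
theorem plaqSwap_snd (k : Fin d) (x : Site d L) (o : Orient d) : (plaqSwap 0 k (x, o)).2 = oSwap (L := L) k o := rfl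

omit [NeZero L] in
/-- In-plane axes of the exchanged orientation. -/
theorem inPlane_oSwap (k : Fin d) (o : Orient d) (m : Fin d) :
    InPlane (oSwap (L := L) k o) m ↔ InPlane o (Equiv.swap 0 k m) := by
  unfold oSwap plaqSwap InPlane
  simp only
  by_cases h : Equiv.swap 0 k o.1.1 < Equiv.swap 0 k o.1.2
  · simp only [h, ↓reduceDIte]
    constructor
    · rintro (h1 | h1)
      · left; rw [← h1, Equiv.swap_apply_self]
      · right; rw [← h1, Equiv.swap_apply_self]
    · rintro (h1 | h1)
      · left; rw [h1, Equiv.swap_apply_self]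
      · right; rw [h1, Equiv.swap_apply_self]
  · simp only [h, ↓reduceDIte]
    constructor
    · rintro (h1 | h1)
      · right; rw [← h1, Equiv.swap_apply_self]
      · left; rw [← h1, Equiv.swap_apply_self]
    · rintro (h1 | h1)
      · right; rw [h1, Equiv.swap_apply_self]
      · left; rw [h1, Equiv.swap_apply_self]

omit [NeZero L] in
/-- `rowShift` of the exchanged orientation. -/
theorem rowShift_oSwap (k : Fin d) (o : Orient d) (m : Fin d) :
    rowShift L (oSwap (L := L) k o) m = rowShift L o (Equiv.swap 0 k m) := by
  unfold rowShift
  by_cases h : InPlane o (Equiv.swap 0 k m)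
  · rw [if_pos ((inPlane_oSwap (L := L) k o m).2 h), if_pos h]
  · rw [if_neg (fun h' => h ((inPlane_oSwap (L := L) k o m).1 h')), if_neg h]

omit [NeZero L] in
/-- **The dictionary intertwines the axis exchange**: `plaqSwap 0 k (toPlaq o c) = toPlaq (oSwap k o) (swapIdx k c)`. -/
theorem plaqSwap_toPlaq (k : Fin d) (o : Orient d) (c : BlockIdx d L) :
    plaqSwap 0 k (toPlaq o c) = toPlaq (oSwap (L := L) k o) (swapIdx k c) := by
  refine Prod.ext (funext fun m => ?_) ?_
  · rw [plaqSwap_fst, toPlaq_fst, toPlaq_fst, swapIdx_apply, rowShift_oSwap]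
  · exact plaqSwap_snd k _ o

omit [NeZero L] in
/-- The image version of `plaqSwap_toPlaq`. -/
theorem image_toPlaq_image_swapIdx (k : Fin d) (o : Orient d) (A : Finset (BlockIdx d L)) :
    (A.image (swapIdx k)).image (toPlaq (oSwap (L := L) k o)) = (A.image (toPlaq o)).image (plaqSwap 0 k) := by
  rw [Finset.image_image, Finset.image_image]
  exact Finset.image_congr fun c _ => (plaqSwap_toPlaq k o c).symm

omit [NeZero L] in
/-- The axis exchange conjugates the reflections: `swapIdx k (cellReflect k 1 c) = cellReflect 0 1 (swapIdx k c)`. -/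
theorem swapIdx_cellReflect (k : Fin d) (c : BlockIdx d L) :
    swapIdx k (cellReflect k 1 c) = cellReflect 0 1 (swapIdx k c) := by
  funext m
  rw [swapIdx_apply, cellReflect_apply, cellReflect_apply]
  by_cases hm : m = 0
  · subst hm
    rw [Equiv.swap_apply_left, Function.update_self, Function.update_self, swapIdx_apply,
      Equiv.swap_apply_left]
  · rw [Function.update_of_ne hm, swapIdx_apply]
    by_cases hmk : m = k
    · subst hmk
      rw [Equiv.swap_apply_right, Function.update_of_ne (Ne.symm hm)]
    · rw [Equiv.swap_apply_of_ne_of_ne hm hmk, Function.update_of_ne hmk]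

/-- The axis exchange conjugates the closed positive half-lines. -/
theorem swapIdx_mem_chalfPlus (k : Fin d) (c : BlockIdx d L) :
    swapIdx k c ∈ chalfPlus L 0 ↔ c ∈ chalfPlus L k := by
  simp [mem_chalfPlus]

/-- The axis exchange conjugates the tree's negative half-lines. -/
theorem swapIdx_mem_halfMinus (k : Fin d) (c : BlockIdx d L) :
    swapIdx k c ∈ halfMinus L 0 1 ↔ c ∈ halfMinus L k 1 := by
  simp [mem_halfMinus]

/-- `swapIdx k '' (csymP k A) = csymP 0 (swapIdx k '' A)`. -/
theorem image_swapIdx_csymP (k : Fin d) (A : Finset (BlockIdx d L)) :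
    (csymP k A).image (swapIdx k) = csymP 0 (A.image (swapIdx k)) := by
  ext c
  simp only [csymP, Finset.mem_image, Finset.mem_union, Finset.mem_inter]
  constructor
  · rintro ⟨b, hb, rfl⟩
    rcases hb with ⟨hbA, hbC⟩ | ⟨b', hb', rfl⟩
    · exact Or.inl ⟨⟨b, hbA, rfl⟩, (swapIdx_mem_chalfPlus k b).2 hbC⟩
    · obtain ⟨hb'A, hb'C⟩ := hb'
      refine Or.inr ⟨swapIdx k b', ⟨⟨b', hb'A, rfl⟩, (swapIdx_mem_chalfPlus k b').2 hb'C⟩, ?_⟩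
      rw [swapIdx_cellReflect]
  · rintro (⟨⟨b, hbA, rfl⟩, hC⟩ | ⟨b', hb', hc⟩)
    · exact ⟨b, Or.inl ⟨hbA, (swapIdx_mem_chalfPlus k b).1 hC⟩, rfl⟩
    · obtain ⟨⟨b, hbA, rfl⟩, hbC⟩ := hb'
      refine ⟨cellReflect k 1 b, Or.inr ⟨b, ⟨hbA, (swapIdx_mem_chalfPlus k b).1 hbC⟩, rfl⟩, ?_⟩
      rw [swapIdx_cellReflect, hc]

/-- `swapIdx k '' (symM k 1 A) = symM 0 1 (swapIdx k '' A)`. -/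
theorem image_swapIdx_symM (k : Fin d) (A : Finset (BlockIdx d L)) :
    (symM k 1 A).image (swapIdx k) = symM 0 1 (A.image (swapIdx k)) := by
  ext c
  simp only [symM, Finset.mem_image, Finset.mem_union, Finset.mem_inter]
  constructor
  · rintro ⟨b, hb, rfl⟩
    rcases hb with ⟨hbA, hbC⟩ | ⟨b', hb', rfl⟩
    · exact Or.inl ⟨⟨b, hbA, rfl⟩, (swapIdx_mem_halfMinus k b).2 hbC⟩
    · obtain ⟨hb'A, hb'C⟩ := hb'
      refine Or.inr ⟨swapIdx k b', ⟨⟨b', hb'A, rfl⟩, (swapIdx_mem_halfMinus k b').2 hb'C⟩, ?_⟩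
      rw [swapIdx_cellReflect]
  · rintro (⟨⟨b, hbA, rfl⟩, hC⟩ | ⟨b', hb', hc⟩)
    · exact ⟨b, Or.inl ⟨hbA, (swapIdx_mem_halfMinus k b).1 hC⟩, rfl⟩
    · obtain ⟨⟨b, hbA, rfl⟩, hbC⟩ := hb'
      refine ⟨cellReflect k 1 b, Or.inr ⟨b, ⟨hbA, (swapIdx_mem_halfMinus k b).1 hbC⟩, rfl⟩, ?_⟩
      rw [swapIdx_cellReflect, hc]

/-! ### §6. The chessboard functional of one orientation -/

/-- **The chessboard functional**: `ψ_o(A) = ⟨exp(c ∑_{x ∈ A} φ_{toPlaq o x})⟩_{Λ,β}`. -/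
def psi (β c : ℝ) (o : Orient d) (A : Finset (BlockIdx d L)) : ℝ :=
  wilsonExpectation ρ β (expObs (G := G) ρ c (A.image (toPlaq o)))

omit [NeZero d] in
/-- `ψ_o(A) ≥ 0`. -/
theorem psi_nonneg (β c : ℝ) (o : Orient d) (A : Finset (BlockIdx d L)) : 0 ≤ psi (G := G) ρ β c o A := by
  unfold psi; exact wilsonExpectation_expObs_nonneg ρ β c (A.image (toPlaq o))

omit [NeZero d] in
/-- `ψ_o(∅) = 1`. -/
theorem psi_empty (hρ : Continuous ρ) (β c : ℝ) (o : Orient d) :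
    psi (G := G) ρ β c o (∅ : Finset (BlockIdx d L)) = 1 := by
  haveI := isProbabilityMeasure_wilsonMeasure (d := d) (L := L) (G := G) ρ hρ β
  unfold psi wilsonExpectation
  simp [expObs]

omit [NeZero d] in
/-- `ψ_o(A) ≥ 1` for `c ≥ 0` (every plaquette cost is non-negative). -/
theorem one_le_psi (hρ : Continuous ρ) (β : ℝ) {c : ℝ} (hc : 0 ≤ c) (o : Orient d) (A : Finset (BlockIdx d L)) :
    1 ≤ psi (G := G) ρ β c o A := by
  haveI := isProbabilityMeasure_wilsonMeasure (d := d) (L := L) (G := G) ρ hρ β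
  have hρN : ∀ g : G, (ρ g).trace.re ≤ N := fun g => by
    have h := Literature.RepresentationTheory.CompactGroups.CompactGroup.abs_re_trace_le_card ρ hρ g
    simp only [Fintype.card_fin] at h
    exact (le_abs_self _).trans h
  obtain ⟨C, hC⟩ := exists_abs_expObs_le (G := G) ρ hρ c (A.image (toPlaq o))
  have h1 : ∀ U : GaugeConfig d L G, (1 : ℝ) ≤ expObs ρ c (A.image (toPlaq o)) U := fun U => by
    rw [expObs]
    exact Real.one_le_exp (mul_nonneg hc (Finset.sum_nonneg fun q _ => plaquetteCost_nonneg ρ hρN _ _ _ U))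
  unfold psi wilsonExpectation
  calc (1 : ℝ) = ∫ _U, (1 : ℝ) ∂(wilsonMeasure ρ β) := by rw [integral_const, probReal_univ, one_smul]
    _ ≤ ∫ U, expObs ρ c (A.image (toPlaq o)) U ∂(wilsonMeasure ρ β) :=
        integral_mono (integrable_const _) (integrable_wilsonMeasure_of_abs_le ρ hρ β
          (measurable_expObs ρ hρ c _) hC) h1

omit [NeZero d] in
/-- **Translation invariance**: `ψ_o(A + a eₖ) = ψ_o(A)`. -/
theorem psi_translate (β c : ℝ) (o : Orient d) (k : Fin d) (a : ZMod L) (A : Finset (BlockIdx d L)) :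
    psi (G := G) ρ β c o (A.image (cellTranslate k a)) = psi ρ β c o A := by
  unfold psi
  rw [image_toPlaq_image_cellTranslate, wilsonExpectation_expObs_plaqTranslate]

/-- **Axis-exchange invariance**: `ψ_o(A) = ψ_{oSwap k o}(swapIdx k '' A)`. -/
theorem psi_swap (hρ : Continuous ρ) (β c : ℝ) (o : Orient d) (k : Fin d) (A : Finset (BlockIdx d L)) :
    psi (G := G) ρ β c (oSwap (L := L) k o) (A.image (swapIdx k)) = psi ρ β c o A := by
  unfold psi
  rw [image_toPlaq_image_swapIdx, wilsonExpectation_expObs_swap ρ hρ]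

end Summit.QuantumFields.YangMills.Theorems.OddTorusChessboard

end
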